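/-
Copyright (c) 2026. All rights reserved.
Released under Apache 2.0 license as described in the file LICENSE.
Authors: abc-iut cell, wave-5 seat abc-iut-w5-d188 (row HATZPOW-PI part 2: non-vacuity of (∗)_Σ;
successor residue of abc-iut-w6-d074's row THM26II-SIGMA-STAR).
-/
import Mathlib.Topology.MetricSpace.Ultra.TotallySeparated
import Literature.AnabelianGeometry.AbsoluteAnabelian.AbsTopIThm26iiSigmaStar
import Literature.AnabelianGeometry.AbsoluteAnabelian.AbsAnabLemma114HypothesesZHatModel
import Literature.AnabelianGeometry.AbsoluteAnabelian.FreeProSigmaCyclicSubgroups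
import HarnessLib

/-!
# [AbsTopI] Thm 2.6 (ii): condition (∗)_Σ AT THE MODEL `Δ ≅ Ẑ_Σ` central — non-vacuity of the
# any-`Σ` input with `m = 1`, for EVERY prime set `Σ`

S. Mochizuki, *Topics in Absolute Anabelian Geometry I* (2012) [AbsTopI], Thm 2.6 (ii), proof p. 23
("`Q_l := Q ⊗ ℤ_l` […] the `ℤ_l`-ranks of `R_l`, `Q_l` are independent of `l ∈ Σ`"), typed by
abc-iut-w6-d074 as the HYPOTHESIS predicate `FundamentalExtension.SigmaStarCondition Σ`
(`AbsTopIThm26iiSigmaStar.lean`, p438448): for every open `Π″ ⊆ Π`, `Δ″/R ≅ Ẑ_Σ^m = ∏_{l ∈ Σ} ℤ_l^m`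
for some `m`.  The only instance recorded so far is the degenerate `Δ = 1` (`m = 0`,
`sigmaStarCondition_of_geom_eq_bot`); abc-iut-w6-d074's closing line names the residue "no
non-vacuity witness of (∗)_Σ with `m ≥ 1` inside the predicate".

PROOF-ONLY companion (no definition, no instance, no notation; nothing landed is edited), the
`Σ`-analogue of abc-iut-f-053's `AbsAnabLemma114HypothesesZHatModel.lean` (the `Ẑ`-model of (∗)):

* `AbsTopII.IsFreeProSigmaCyclic.eq_one_of_pow_eq_one` — a free pro-`Σ`-cyclic profinite group
  ("`≅ Ẑ^Σ`", abc-iut-L4-t6's intrinsic predicate) is torsion-free (transport to `∏_{p ∈ Σ} ℤ_p`);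
  `….isTopologicallyFinitelyGenerated`; `….nonempty_continuousMulEquiv_hatZSigmaPow_one` — it is
  `≃ₜ* Ẑ_Σ^1 = HatZSigmaPow Σ 1`;
* **(∗)_Σ at the model** `sigmaStarCondition_of_isFreeProSigmaCyclic_of_central` — if `Δ` is free
  pro-`Σ`-cyclic and central in `Π`, then (∗)_Σ holds at EVERY open `Π″ ⊆ Π` with `m = 1`: `Δ″ = Δ ∩ Π″`
  is open in `Δ`, hence again `≅ Ẑ^Σ` (abc-iut's `IsFreeProSigmaCyclic.subgroup_of_isOpen`), and the
  radical `coinvRadical Π″` is trivial (`Δ″` abelian, torsion-free, with trivial `Π″`-action);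
* **non-vacuity** `exists_splits_tfg_sigmaStar_of_profiniteGrp` — for EVERY `Σ` and EVERY profinite
  `G`, the split central extension `1 → Ẑ^Σ → Ẑ^Σ × G → G → 1` has `Δ ≅ Ẑ^Σ` (free pro-`Σ`-cyclic, so
  `Δ ≠ 1` as soon as `Σ` contains a prime), splits over the open subgroup `G`, has `Δ` topologically
  finitely generated, and satisfies (∗)_Σ (with `m = 1` at every open `Π″`);
  `exists_mlfBase_sigmaStar_hypotheses` — the same over every MLF base `(p, K, G ≅ G_K)`, i.e. the
  hypotheses "splits over an open subgroup" + (∗)_Σ of abc-iut-w6-d074's any-`Σ` closer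
  `thm26ii_of_sigmaStarCondition` are jointly satisfiable with `Δ ≅ Ẑ^Σ ≠ 1` for every `Σ ∋` a prime.

HONEST SCOPE: a MODEL-level instance form (the split extension with trivial action, not claimed to be
the `π₁` of a curve); classical profinite group theory [cite: RibesZalesskii2010, Thm 2.7.1]; (∗)_Σ
stays a typed INPUT elsewhere; nothing here bears on [IUTchIII] Cor. 3.12 or takes a side; typed ≠
proved elsewhere.
-/

noncomputable section

open Topology

namespace Literature.AnabelianGeometry.AbsoluteAnabelian

universe u

/-! ### Free pro-`Σ`-cyclic profinite groups: torsion-freeness, finite generation, `≃ₜ* Ẑ_Σ^1` -/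

section FreeProSigmaCyclic

variable {G : Type u} [Group G] [TopologicalSpace G] [IsTopologicalGroup G]

/-- **A free pro-`Σ`-cyclic profinite group is torsion-free**: `x ^ n = 1`, `n ≠ 0` ⇒ `x = 1`
(transport to `∏_{p ∈ Σ} ℤ_p`, each `ℤ_p` being a domain of characteristic zero).
[cite: MochizukiAbsTopII2013, Prop 1.3 (i) p.11] -/
theorem AbsTopII.IsFreeProSigmaCyclic.eq_one_of_pow_eq_one {S : Set ℕ} [CompactSpace G] [T2Space G]
    [TotallyDisconnectedSpace G] (h : AbsTopII.IsFreeProSigmaCyclic S G) {x : G} {n : ℕ} (hn : n ≠ 0)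
    (hx : x ^ n = 1) : x = 1 := by
  obtain ⟨e, -⟩ := h.exists_continuousMulEquiv_padicSigmaProd
  have h1 : Multiplicative.toAdd (e x) = 0 := by
    have h2 : n • Multiplicative.toAdd (e x) = 0 := by
      rw [← toAdd_pow, ← map_pow, hx, map_one, toAdd_one]
    funext p
    have h3 : (n : @PadicInt (p.1 : ℕ) ⟨p.1.2⟩) * Multiplicative.toAdd (e x) p = 0 := by
      have := congrFun h2 p
      rwa [Pi.smul_apply, nsmul_eq_mul, Pi.zero_apply] at this
    haveI : Fact (Nat.Prime (p.1 : ℕ)) := ⟨p.1.2⟩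
    rcases mul_eq_zero.mp h3 with h4 | h4
    · exact absurd h4 (Nat.cast_ne_zero.mpr hn)
    · exact h4
  have h5 : e x = 1 := by
    rw [← ofAdd_toAdd (e x), h1]; rfl
  exact e.injective (h5.trans (map_one e).symm)

/-- "`≅ Ẑ^Σ`" is topologically finitely generated (by one element).
[cite: MochizukiAbsTopII2013, Prop 1.3 (i) p.11] -/
theorem AbsTopII.IsFreeProSigmaCyclic.isTopologicallyFinitelyGenerated {S : Set ℕ} [T2Space G]
    (h : AbsTopII.IsFreeProSigmaCyclic S G) : IsTopologicallyFinitelyGenerated G := by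
  classical
  obtain ⟨g, hg⟩ := h.exists_dense_zpowers
  refine ⟨⟨{g}, ?_⟩⟩
  apply SetLike.coe_injective
  rw [Subgroup.topologicalClosure_coe, Subgroup.coe_top, Finset.coe_singleton,
    ← Subgroup.zpowers_eq_closure, hg.closure_eq]

/-- **A free pro-`Σ`-cyclic profinite group is `≃ₜ* Ẑ_Σ^1`** (abc-iut-w6-d074's model
`HatZSigmaPow Σ 1 = (∏_{l ∈ Σ} ℤ_l)^1`): the structure theorem
`IsFreeProSigmaCyclic.exists_continuousMulEquiv_padicSigmaProd` followed by re-indexing.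
[cite: MochizukiAbsTopII2013, Prop 1.3 (i) p.11] -/
theorem AbsTopII.IsFreeProSigmaCyclic.nonempty_continuousMulEquiv_hatZSigmaPow_one {S : Set ℕ}
    [CompactSpace G] [T2Space G] [TotallyDisconnectedSpace G] (h : AbsTopII.IsFreeProSigmaCyclic S G) :
    Nonempty (G ≃ₜ* HatZSigmaPow S 1) := by
  obtain ⟨e, -⟩ := h.exists_continuousMulEquiv_padicSigmaProd
  let r : Multiplicative (∀ p : {p : Nat.Primes // (p : ℕ) ∈ S}, @PadicInt (p.1 : ℕ) ⟨p.1.2⟩) ≃ₜ*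
      HatZSigmaPow S 1 :=
    { toFun := fun x => Multiplicative.ofAdd fun (_ : Fin 1) (l : {l : ℕ // l.Prime ∧ l ∈ S}) =>
        Multiplicative.toAdd x ⟨⟨l.1, l.2.1⟩, l.2.2⟩
      invFun := fun y => Multiplicative.ofAdd fun p : {p : Nat.Primes // (p : ℕ) ∈ S} =>
        Multiplicative.toAdd y 0 ⟨p.1.1, p.1.2, p.2⟩
      left_inv := fun x => rfl
      right_inv := fun y => by
        refine congrArg Multiplicative.ofAdd (funext fun j => funext fun l => ?_)
        rw [Fin.fin_one_eq_zero j]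
        rfl
      map_mul' := fun x y => rfl
      continuous_toFun := continuous_ofAdd.comp (continuous_pi fun _ => continuous_pi fun l =>
        (continuous_apply _).comp continuous_toAdd)
      continuous_invFun := continuous_ofAdd.comp (continuous_pi fun p =>
        (continuous_apply _).comp ((continuous_apply 0).comp continuous_toAdd)) }
  exact ⟨e.trans r⟩

end FreeProSigmaCyclic

/-! ### (∗)_Σ at the model: `Δ ≅ Ẑ^Σ` central -/

namespace FundamentalExtension

variable (E : FundamentalExtension.{u})

/-- **[AbsTopI] Thm 2.6 (ii) (∗)_Σ AT THE MODEL `Δ ≅ Ẑ^Σ` CENTRAL.**  If `Δ = Ker(Π ↠ G)` is free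
pro-`Σ`-cyclic ("`≅ Ẑ^Σ`") and central in `Π`, then (∗)_Σ holds at every open `Π″ ⊆ Π`, with
`m = 1`: `Δ″ = Δ ∩ Π″` is open in `Δ`, hence `≅ Ẑ^Σ ≅ Ẑ_Σ^1`; and the radical `coinvRadical Π″` is
trivial, `1` being closed, normal, root-closed in the torsion-free `Δ″` and containing the commutators
`[Π″, Δ″] = 1` — so "the maximal torsion-free quotient on which `G` acts trivially" is `Δ″ ≅ Ẑ_Σ`
itself. [cite: MochizukiAbsTopI2012, Thm 2.6 (ii) proof p.23] -/
theorem sigmaStarCondition_of_isFreeProSigmaCyclic_of_central {S : Set ℕ}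
    (hZ : AbsTopII.IsFreeProSigmaCyclic S E.geom)
    (hc : ∀ g : E.arith, ∀ d ∈ E.geom, g * d = d * g) : E.SigmaStarCondition S := by
  intro P hP
  haveI : CompactSpace E.geom := isCompact_iff_compactSpace.mp E.isClosed_geom.isCompact
  have hDc : IsClosed ((E.geom ⊓ P : Subgroup E.arith) : Set E.arith) := by
    rw [Subgroup.coe_inf]
    exact E.isClosed_geom.inter (P.isClosed_of_isOpen hP)
  haveI : CompactSpace ↥(E.geom ⊓ P) := isCompact_iff_compactSpace.mp hDc.isCompact
  -- `Δ ∩ P`, seen inside `Δ`, is the open subgroup `P ∩ Δ` of `Δ`: free pro-`Σ`-cyclic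
  have hU : AbsTopII.IsFreeProSigmaCyclic S ↥(P.comap E.geom.subtype) :=
    hZ.subgroup_of_isOpen (P.comap E.geom.subtype) (hP.preimage continuous_subtype_val)
  let t : ↥(P.comap E.geom.subtype) ≃ₜ* ↥(E.geom ⊓ P) :=
    { toFun := fun x => ⟨x.1.1, Subgroup.mem_inf.mpr ⟨x.1.2, x.2⟩⟩
      invFun := fun y => ⟨⟨y.1, (Subgroup.mem_inf.mp y.2).1⟩, (Subgroup.mem_inf.mp y.2).2⟩
      left_inv := fun x => rfl
      right_inv := fun y => rfl
      map_mul' := fun x y => rfl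
      continuous_toFun := (continuous_subtype_val.comp continuous_subtype_val).subtype_mk _
      continuous_invFun := (continuous_subtype_val.subtype_mk _).subtype_mk _ }
  have hD : AbsTopII.IsFreeProSigmaCyclic S ↥(E.geom ⊓ P) := hU.of_continuousMulEquiv t
  obtain ⟨e⟩ := hD.nonempty_continuousMulEquiv_hatZSigmaPow_one
  -- the radical of `Δ ∩ P` is trivial
  have hrad : E.coinvRadical P = ⊥ := by
    refine le_antisymm ?_ bot_le
    unfold coinvRadical
    refine sInf_le ⟨bot_le, ?_, ?_, ?_, ?_⟩
    · rw [Subgroup.coe_bot]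
      exact isClosed_singleton
    · rw [Subgroup.bot_subgroupOf]
      infer_instance
    · intro x hx k hk hxk
      rw [Subgroup.mem_bot] at hxk ⊢
      have h1 : (⟨x, hx⟩ : ↥(E.geom ⊓ P)) ^ k = 1 := Subtype.ext hxk
      exact congrArg Subtype.val (hD.eq_one_of_pow_eq_one hk.ne' h1)
    · intro g _ d hd
      rw [Subgroup.mem_bot, hc g d (Subgroup.mem_inf.mp hd).1, mul_inv_cancel_right, mul_inv_cancel]
  refine ⟨1, ContinuousMonoidHom.mk e.toMulEquiv.toMonoidHom e.continuous, e.surjective,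
    fun x => ?_⟩
  rw [hrad, Subgroup.mem_bot]
  change e x = 1 ↔ (x : E.arith) = 1
  constructor
  · intro hx
    rw [e.injective (hx.trans (map_one e).symm)]
    rfl
  · intro hx
    rw [show x = 1 from Subtype.ext hx, map_one]

/-! ### The split model `Π = Ẑ^Σ × G ↠ G` -/

/-- **Non-vacuity of (∗)_Σ with `Δ ≅ Ẑ^Σ`, over ANY profinite `G` and for EVERY `Σ`.**  The split
central extension `1 → Ẑ^Σ → Ẑ^Σ × G → G → 1` (`Ẑ^Σ = ∏_{p ∈ Σ} ℤ_p`, second projection) has `Δ ≅ Ẑ^Σ`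
free pro-`Σ`-cyclic, splits over the open subgroup `G` itself (the section `g ↦ (1, g)`), has `Δ`
topologically finitely generated, and satisfies (∗)_Σ — with `m = 1` at every open `Π″`
(`sigmaStarCondition_of_isFreeProSigmaCyclic_of_central`). [cite: MochizukiAbsTopI2012, Thm 2.6 (ii) proof p.23] -/
theorem exists_splits_tfg_sigmaStar_of_profiniteGrp (S : Set ℕ) (G : ProfiniteGrp.{0}) :
    ∃ E : FundamentalExtension.{0}, Nonempty (E.gal ≃ₜ* G) ∧ AbsTopII.IsFreeProSigmaCyclic S E.geom ∧
      E.SplitsOverOpenSubgroup ∧ IsTopologicallyFinitelyGenerated E.geom ∧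
      E.SigmaStarCondition S := by
  let T : Type := Multiplicative (∀ p : {p : Nat.Primes // (p : ℕ) ∈ S}, @PadicInt (p.1 : ℕ) ⟨p.1.2⟩)
  haveI : ∀ p : {p : Nat.Primes // (p : ℕ) ∈ S}, Fact (Nat.Prime (p.1 : ℕ)) := fun p => ⟨p.1.2⟩
  haveI : CompactSpace T :=
    inferInstanceAs (CompactSpace (∀ p : {p : Nat.Primes // (p : ℕ) ∈ S}, @PadicInt (p.1 : ℕ) ⟨p.1.2⟩))
  haveI : T2Space T :=
    inferInstanceAs (T2Space (∀ p : {p : Nat.Primes // (p : ℕ) ∈ S}, @PadicInt (p.1 : ℕ) ⟨p.1.2⟩))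
  haveI : TotallyDisconnectedSpace T :=
    inferInstanceAs (TotallyDisconnectedSpace
      (∀ p : {p : Nat.Primes // (p : ℕ) ∈ S}, @PadicInt (p.1 : ℕ) ⟨p.1.2⟩))
  haveI : IsTopologicalGroup T := inferInstance
  have hT : AbsTopII.IsFreeProSigmaCyclic S T := isFreeProSigmaCyclic_padicProdOn S
  let E : FundamentalExtension.{0} :=
    { arith := ProfiniteGrp.of (T × G)
      gal := G
      aug := ContinuousMonoidHom.snd T G
      aug_surjective := fun g => ⟨(1, g), rfl⟩ }
  have hmem : ∀ x : T × G, (x : E.arith) ∈ E.geom ↔ x.2 = 1 := fun x => Iff.rfl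
  -- `Δ = Ẑ^Σ × 1 ≃ₜ* Ẑ^Σ`
  let t : ↥E.geom ≃ₜ* T :=
    { toFun := fun x => (x.1 : T × G).1
      invFun := fun z => ⟨((z, 1) : T × G), (hmem _).mpr rfl⟩
      left_inv := fun x => Subtype.ext (Prod.ext rfl ((hmem x.1).mp x.2).symm)
      right_inv := fun z => rfl
      map_mul' := fun x y => rfl
      continuous_toFun := continuous_fst.comp continuous_subtype_val
      continuous_invFun := (continuous_id.prodMk continuous_const).subtype_mk _ }
  have hZ : AbsTopII.IsFreeProSigmaCyclic S E.geom := hT.of_continuousMulEquiv t.symm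
  -- `Ẑ^Σ` is commutative, so `Δ = Ẑ^Σ × 1` is central in `Ẑ^Σ × G`
  have hcommT : ∀ a b : T, a * b = b * a := fun a b => mul_comm a b
  have hc' : ∀ g d : T × G, d.2 = 1 → g * d = d * g := fun g d hd =>
    Prod.ext (hcommT g.1 d.1) (by rw [Prod.snd_mul, Prod.snd_mul, hd, mul_one, one_mul])
  have hc : ∀ g : E.arith, ∀ d ∈ E.geom, g * d = d * g := fun g d hd => hc' g d ((hmem d).mp hd)
  exact ⟨E, ⟨ContinuousMulEquiv.refl _⟩, hZ,
    E.splitsOverOpenSubgroup_of_section (ContinuousMonoidHom.inr T G) (fun _ => rfl),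
    hZ.isTopologicallyFinitelyGenerated, E.sigmaStarCondition_of_isFreeProSigmaCyclic_of_central hZ hc⟩

/-- **`Δ ≠ 1` in the model as soon as `Σ` contains a prime**: a free pro-`Σ`-cyclic group with
`l ∈ Σ` prime has an open subgroup of index `l`, so is not trivial.
[cite: MochizukiAbsTopII2013, Prop 1.3 (i) p.11] -/
theorem _root_.Literature.AnabelianGeometry.AbsoluteAnabelian.AbsTopII.IsFreeProSigmaCyclic.nontrivial_of_prime_mem
    {G : Type u} [Group G] [TopologicalSpace G] {S : Set ℕ} (h : AbsTopII.IsFreeProSigmaCyclic S G)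
    {l : ℕ} (hl : l.Prime) (hlS : l ∈ S) : Nontrivial G := by
  obtain ⟨H, -, hH⟩ := (h.isOpen_index_iff l).mpr
    ⟨hl.pos, fun q hq hql => by rwa [(Nat.prime_dvd_prime_iff_eq hq hl).mp hql]⟩
  by_contra hG
  rw [not_nontrivial_iff_subsingleton] at hG
  have h1 : H.index = 1 := by
    rw [Subgroup.index_eq_one]
    exact (Subgroup.eq_top_iff' H).mpr fun x => by rw [Subsingleton.elim x 1]; exact H.one_mem
  exact hl.one_lt.ne' (hH.symm.trans h1)

/-- **Non-vacuity of the hypotheses of the any-`Σ` closer `thm26ii_of_sigmaStarCondition` over every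
MLF base, with `Δ ≅ Ẑ^Σ`.**  For every finite extension `K/ℚ_p` and every `Σ` there is an extension
`E` with MLF base data `(p, K, G ≅ G_K)` whose `Δ` is free pro-`Σ`-cyclic — nontrivial as soon as
`Σ` contains a prime — which splits over an open subgroup of `G`, has `Δ` topologically finitely
generated, and satisfies (∗)_Σ: namely `Ẑ^Σ × G_K ↠ G_K`.  (The remaining hypothesis "`Π`
topologically finitely generated" of the closer is about `G_K` and is supplied Summits-side /
from local EPC, cf. `thm26ii_of_sigmaStarCondition_of_localEPC`.)
[cite: MochizukiAbsTopI2012, Thm 2.6 (ii) proof p.23] -/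
theorem exists_mlfBase_sigmaStar_hypotheses (S : Set ℕ) (p : ℕ) [Fact p.Prime] (K : Type) [Field K]
    [Algebra ℚ_[p] K] [FiniteDimensional ℚ_[p] K] :
    ∃ (E : FundamentalExtension.{0}) (B : E.MLFBase), B.p = p ∧
      AbsTopII.IsFreeProSigmaCyclic S E.geom ∧ (∀ l : ℕ, l.Prime → l ∈ S → Nontrivial E.geom) ∧
      E.SplitsOverOpenSubgroup ∧ IsTopologicallyFinitelyGenerated E.geom ∧
      E.SigmaStarCondition S := by
  haveI : CharZero K := charZero_of_injective_algebraMap (algebraMap ℚ_[p] K).injective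
  obtain ⟨E, ⟨e⟩, hZ, hs, htfg, hstar⟩ :=
    exists_splits_tfg_sigmaStar_of_profiniteGrp S (absoluteGaloisGrp K)
  exact ⟨E, { p := p, K := K, galIso := e }, rfl, hZ, fun l hl hlS => hZ.nontrivial_of_prime_mem hl hlS,
    hs, htfg, hstar⟩

end FundamentalExtension

end Literature.AnabelianGeometry.AbsoluteAnabelian

end
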